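import Summits.PneNP.PneNP.Theses.RootDecompDepthDial
import Literature.Computability.Complexity.ConstantDepth
import Literature.Computability.Complexity.CircuitLightCone
import Literature.Computability.Complexity.CircuitRestriction
import Literature.Computability.Complexity.Transducers

/-!
# `RootDecompDepthDial.TransferNCZero` (stmt-PneNP-31547) — the decided bottom notch `k = 0` of the depth dial

Node N32 of the decomp-pnenp root-decomposition cell (route `route-PneNP-RootDecompDepthDial`) records, as
an aside, the DECIDED notch `k = 0` of its depth-exponent dial: `NP ⊆ P → ¬(P ⊆ NC⁰)` — true outright,
because `P ⊄ NC⁰`: the disjunction language `ORL = {z | some bit of z is 1}` is in `P` (a two-state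
finite-state transduction, tree `FST`) but not in `NC 0` (a `B₂`-circuit of `acDepth ≤ 2c` has a light cone
of at most `2^{2c}` inputs — negations do not enlarge it —, so on `n = 2^{2c} + 1` inputs flipping an unread
bit of `0ⁿ` changes membership but not the output; tree `Circuit.eval_congr_lightCone`).  Verbatim port
(declarations made `private`) of the lens-2 g9 kernel block `eval_length_cast`, `card_deps_le_two_pow_wdepths`,
`card_lightCone_le_two_pow_acDepth`, `orAcc`/`ORL`/`orT`, `ORL_mem_P`, `ORL_not_mem_NC_zero`,
`not_P_subset_NC_zero` (DepthDial.lean d6eaa8c4, §4–§5), certified closable by the cell critic\'s anchor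
probe Anchor_N32_DepthDial.lean b0b8f749 (`tree_transferNCZero_holds := lens transferNCk_zero`,
2026-08-30T09:16:24Z).  [BravyiGossetKonig2018 §2; folklore]  0 sorry.
-/

namespace Summit.PneNP.PneNP.Theorems

open Literature.Computability.Complexity Finset
open Literature.Computability.Complexity.GateList

/-- Transport of a circuit family along a length identity (bookkeeping). -/
private theorem eval_length_cast (C : CircuitFamily) (y : List Bool) {n : ℕ} (h : y.length = n) :
    (C n).eval (fun j : Fin n => y[(j : ℕ)]'(h ▸ j.2)) = (C y.length).eval y.get := by
  subst h
  rfl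

/-- A gate equal to `¬` has arity `1`. -/
private theorem arity_eq_one_of_fn_eq_not {ι : Type*} (g : Gate ι) (h : g.fn = GateFn.not) : g.arity = 1 :=
  congrArg Sigma.fst h

/-- **Light cones under negation-free depth.** Over `B₂` the dependency set of gate `m` has at most
`2 ^ (acWeight-depth of m)` inputs: a negation (weight 0) has ONE argument and does not enlarge the cone;
every other gate (weight 1) has at most two arguments and at most doubles it.
[BravyiGossetKonig2018 §2 Eq. (5), negations free] -/
private theorem card_deps_le_two_pow_wdepths {ι : Type*} [DecidableEq ι] (gs : List (Gate ι))
    (hgs : ∀ g ∈ gs, g.arity ≤ 2) :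
    ∀ m, ((deps gs).getD m ∅).card ≤ 2 ^ ((wdepths acWeight gs).getD m 0) := by
  induction gs using List.reverseRecOn with
  | nil => intro m; simp
  | append_singleton gs g ih =>
    intro m
    have hgs' : ∀ g' ∈ gs, g'.arity ≤ 2 := fun g' hg' => hgs g' (by simp [hg'])
    have hg : g.arity ≤ 2 := hgs g (by simp)
    rw [deps_append_singleton, wdepths_append_singleton]
    rcases lt_or_ge m gs.length with h | h
    · rw [List.getD_append _ _ _ _ (by simpa using h),
        List.getD_append _ _ _ _ (by simpa using h)]
      exact ih hgs' m
    · rw [List.getD_append_right _ _ _ _ (by simpa using h),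
        List.getD_append_right _ _ _ _ (by simpa using h)]
      rcases lt_or_ge (m - gs.length) 1 with h1 | h1
      · have h0d : m - (deps gs).length = 0 := by simp; omega
        have h0e : m - (wdepths acWeight gs).length = 0 := by simp; omega
        rw [h0d, h0e, List.getD_cons_zero, List.getD_cons_zero]
        unfold depOf
        set D : Fin g.arity → ℕ := fun a => wireDepthOf (wdepths acWeight gs) (g.args a) with hD
        have hcard : (univ : Finset (Fin g.arity)).card * 2 ^ (univ.sup D) ≤
            2 ^ (acWeight g.fn + univ.sup D) := by
          by_cases hnot : g.fn = GateFn.not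
          · have h1 : g.arity = 1 := arity_eq_one_of_fn_eq_not g hnot
            have hw : acWeight g.fn = 0 := by simp [acWeight, hnot]
            have key : ∀ t : ℕ, g.arity * t ≤ t := fun t => by rw [h1, one_mul]
            rw [hw, zero_add, card_univ, Fintype.card_fin]
            exact key _
          · have hw : acWeight g.fn = 1 := by simp [acWeight, hnot]
            rw [hw, pow_add, pow_one, card_univ, Fintype.card_fin]
            exact Nat.mul_le_mul_right _ hg
        calc (univ.biUnion fun a => match g.args a with
                | .inl i => ({i} : Finset ι)
                | .inr m => (deps gs).getD m ∅).card
            ≤ univ.card * 2 ^ (univ.sup D) := by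
              apply card_biUnion_le_card_mul
              intro a _
              have hDa : D a ≤ univ.sup D := le_sup (mem_univ a)
              cases ha : g.args a with
              | inl i =>
                simp only [card_singleton]
                exact Nat.one_le_two_pow
              | inr m' =>
                calc ((deps gs).getD m' ∅).card ≤ 2 ^ ((wdepths acWeight gs).getD m' 0) := ih hgs' m'
                  _ = 2 ^ (D a) := by rw [hD]; simp only; rw [ha]; rfl
                  _ ≤ 2 ^ (univ.sup D) := Nat.pow_le_pow_right (by norm_num) hDa
          _ ≤ 2 ^ (acWeight g.fn + univ.sup D) := hcard
      · rw [List.getD_eq_default _ _ (by simp; omega)]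
        simp

/-- **`|lightCone C| ≤ 2 ^ acDepth C`** for a circuit over `B₂`. [BravyiGossetKonig2018 §2] -/
private theorem card_lightCone_le_two_pow_acDepth {ι : Type*} [DecidableEq ι] (C : Circuit ι) (hC : C.IsOver B2) :
    C.lightCone.card ≤ 2 ^ C.acDepth := by
  unfold Circuit.lightCone
  rw [Circuit.acDepth, circuit_depthWith]
  cases ho : C.output with
  | inl i => simp
  | inr m =>
    simp only [wireDepthOf_inr]
    exact card_deps_le_two_pow_wdepths C.gates (fun g hg => hC g hg) m

/-- Running disjunction. -/
private def orAcc : Bool → List Bool → Bool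
  | s, [] => s
  | s, b :: z => orAcc (s || b) z

/-- The running disjunction is `true` iff the seed or some bit is. Port of lens-2 g9. [folklore] -/
private theorem orAcc_eq_true_iff (s : Bool) (z : List Bool) : orAcc s z = true ↔ s = true ∨ true ∈ z := by
  induction z generalizing s with
  | nil => simp [orAcc]
  | cons b z ih =>
    rw [orAcc, ih]
    cases s <;> cases b <;> simp

/-- `ORL := {z | some bit of z is 1}` — the disjunction language. [folklore] -/
private def ORL : Language Bool := {z | orAcc false z = true}

/-- Membership in `ORL` = some bit is `1`. Port of lens-2 g9. [folklore] -/
private theorem mem_ORL_iff (z : List Bool) : z ∈ ORL ↔ true ∈ z := by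
  show orAcc false z = true ↔ _
  rw [orAcc_eq_true_iff]; simp

/-- The two-state transducer computing `z ↦ [OR z]`. -/
private def orT : FST Bool Bool Bool where
  init := false
  step s b := (s || b, [])
  front s := [s]
  keep _ := false

/-- The run of the OR transducer computes the running disjunction. Port of lens-2 g9. [folklore] -/
private theorem orT_run (s : Bool) (z : List Bool) : orT.run s z = (orAcc s z, []) := by
  induction z generalizing s with
  | nil => rfl
  | cons b z ih =>
    rw [FST.run_cons]
    have h1 : (orT.step s b).1 = (s || b) := rfl
    have h2 : (orT.step s b).2 = [] := rfl
    rw [h1, h2, ih]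
    rfl

/-- The OR transducer outputs `[OR z]`. Port of lens-2 g9. [folklore] -/
private theorem orT_eval (z : List Bool) : orT.eval z = [orAcc false z] := by
  rw [FST.eval, show orT.init = false from rfl, orT_run]
  rfl

/-- `z ↦ [OR z]` is in `FP` (finite-state transduction). Port of lens-2 g9. [folklore] -/
private theorem orFn_mem_FP : (fun z : List Bool => [orAcc false z]) ∈ FP := by
  rw [← (funext orT_eval : orT.eval = fun z => [orAcc false z])]
  exact orT.polyTimeComputable_eval

/-- **`ORL ∈ P`** (kernel: a finite-state transduction decides it). [folklore] -/
private theorem ORL_mem_P : ORL ∈ Classes.P :=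
  mem_P_of_mem_FP orFn_mem_FP ORL fun z =>
    ⟨fun h => by rw [show orAcc false z = true from h], fun h => by
      have h' : orAcc false z = false := by
        cases hz : orAcc false z with
        | false => rfl
        | true => exact absurd hz h
      rw [h']⟩

/-- **DECIDED (kernel): `ORL ∉ NC⁰`** — same unread-bit flip as for `PARITY`. [folklore] -/
private theorem ORL_not_mem_NC_zero : ORL ∉ NC 0 := by
  rintro ⟨c, p, C, hC, hdec⟩
  set n : ℕ := 2 ^ (2 * c) + 1 with hn
  have hdepth : (C n).acDepth ≤ 2 * c := by
    have h := (hC n).2.1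
    simp only [pow_zero, mul_one] at h
    omega
  have hlt : (C n).lightCone.card < n :=
    calc (C n).lightCone.card ≤ 2 ^ (C n).acDepth := card_lightCone_le_two_pow_acDepth _ (hC n).1
      _ ≤ 2 ^ (2 * c) := Nat.pow_le_pow_right (by norm_num) hdepth
      _ < n := by omega
  obtain ⟨i, hi⟩ : ∃ i : Fin n, i ∉ (C n).lightCone := by
    by_contra h
    push Not at h
    have hsub : (univ : Finset (Fin n)) ⊆ (C n).lightCone := fun i _ => h i
    have := card_le_card hsub
    simp only [card_univ, Fintype.card_fin] at this
    omega
  set x : List Bool := List.replicate n false with hx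
  set x' : List Bool := (List.replicate n false).set i true with hx'
  have hxl : x.length = n := by simp [hx]
  have hxl' : x'.length = n := by simp [hx']
  have hagree : (C n).eval (fun j : Fin n => x[(j : ℕ)]'(j.2.trans_eq hxl.symm)) =
      (C n).eval (fun j : Fin n => x'[(j : ℕ)]'(j.2.trans_eq hxl'.symm)) := by
    apply Circuit.eval_congr_lightCone
    intro j hj
    have hji : (i : ℕ) ≠ (j : ℕ) := fun h => hi (by rwa [show i = j from Fin.ext h])
    simp [hx, hx', hji]
  rw [eval_length_cast C x hxl, eval_length_cast C x' hxl', hdec x, hdec x'] at hagree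
  have h0 : ORL.boolIndicator x = false := (ORL.notMem_iff_boolIndicator x).1 (by
    rw [hx]
    show ¬ (orAcc false (List.replicate n false) = true)
    rw [orAcc_eq_true_iff]; simp)
  have h1 : ORL.boolIndicator x' = true := (ORL.mem_iff_boolIndicator x').1 (by
    rw [hx']
    show orAcc false ((List.replicate n false).set i true) = true
    rw [orAcc_eq_true_iff]
    exact Or.inr (List.mem_iff_getElem.2 ⟨i, by simp, by simp⟩))
  rw [h0, h1] at hagree
  exact Bool.false_ne_true hagree

/-- `P ⊄ NC⁰` (kernel, via `ORL`). -/
private theorem not_P_subset_NC_zero : ¬ (Classes.P ⊆ NC 0) := fun h => ORL_not_mem_NC_zero (h ORL_mem_P)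

/-- `TransferNCZero` (stmt-PneNP-31547): `NP ⊆ P → ¬ (P ⊆ NC 0)` — holds outright since `P ⊄ NC⁰`
(`ORL ∈ P ∖ NC⁰` by the light-cone / unread-bit argument; decomp-pnenp cell N32, notch `k = 0` of the
depth dial; port of lens-2 g9 `transferNCk_zero`, 2026-08-30). -/
theorem transferNCZero_proof :
    Summit.PneNP.PneNP.Theses.RootDecompDepthDial.TransferNCZero := by
  unfold Summit.PneNP.PneNP.Theses.RootDecompDepthDial.TransferNCZero
  exact fun _ => not_P_subset_NC_zero

end Summit.PneNP.PneNP.Theorems
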